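import Summits.NavierStokesRegularity.NavierStokesRegularity.Theorems.FilamentSkeletonRssCoreLinearInvertibilityOddAttenuationDecay
import Summits.AnomalousDissipation.AnomalousDissipation.Theorems.MarginalStabilityChainStretchedVortexRowsStubCoreLAngularPairingTools
import Summits.AnomalousDissipation.AnomalousDissipation.Theorems.MarginalStabilityChainStretchedVortexRowsStubCoreInverseAngular

/-!
# Tools B for stub `stub_oddAttenuation` of crux `CoreLinearInvertibility`
# (stmt-NavierStokesRegularity-17973), line `Sketch`: drift and Laplacian pairings

For `u ∈ C²(ℝ²)` with `u, Du, D²u` of Gaussian decay `e^{−|x|²/8}` (times polynomials) and a `C¹`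
polynomially bounded multiplier `m` with polynomially bounded first derivatives:

* `∫ m u ∂ᵥu = −½ ∫ (∂ᵥm) u²` and its angular version `∫ m u ∂_θu = −½ ∫ (∂_θm) u²`
  (`∂_θu = Du[x^⊥] = −x₁∂₀u + x₀∂₁u`; in particular `∫ m u ∂_θu = 0` for radial `m`);
* `∫ m u Δu = −∫ (m |∇u|² + u ∇m·∇u)` (Green once, in coordinates).

All boundary terms vanish by `integral_fderiv_apply_eq_zero_of_integrable` (tools A).
-/

set_option linter.dupNamespace false

noncomputable section

namespace Summit.NavierStokesRegularity.NavierStokesRegularity.Theorems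

open MeasureTheory Filter Topology Set
open Literature.Analysis.FluidPDE
open Summit.AnomalousDissipation.AnomalousDissipation.Theorems.MarginalStabilityChainStretchedVortexRows
open scoped InnerProductSpace Laplacian ContDiff

section Decay

variable {u : EuclideanSpace ℝ (Fin 2) → ℝ} (hu : ContDiff ℝ 2 u)
  (hB : ∃ (C : ℝ) (N : ℕ), ∀ x, |u x| ≤ C * (1 + ‖x‖) ^ N * Real.exp (-(1 / 8 * ‖x‖ ^ 2)) ∧
      ‖fderiv ℝ u x‖ ≤ C * (1 + ‖x‖) ^ N * Real.exp (-(1 / 8 * ‖x‖ ^ 2)) ∧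
      ‖fderiv ℝ (fderiv ℝ u) x‖ ≤ C * (1 + ‖x‖) ^ N * Real.exp (-(1 / 8 * ‖x‖ ^ 2)))

/-! ### `∫ m u ∂ᵥu = −½ ∫ (∂ᵥm) u²` -/

include hu hB in
/-- **The drift pairing**: `∫ m u ∂ᵥu = −½ ∫ (∂ᵥm) u²` for a `C¹` polynomially bounded multiplier `m`
with polynomially bounded `∂ᵥm` (`∂ᵥ(m u²) = ∂ᵥm u² + 2 m u ∂ᵥu` integrates to zero). [folklore] -/
theorem integral_mul_mul_fderiv_apply_eq_of_gaussDecay {m : EuclideanSpace ℝ (Fin 2) → ℝ}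
    (hm : ContDiff ℝ 1 m) (hm0 : ∃ (C : ℝ) (N : ℕ), ∀ x, |m x| ≤ C * (1 + ‖x‖) ^ N)
    (v : EuclideanSpace ℝ (Fin 2))
    (hm1 : ∃ (C : ℝ) (N : ℕ), ∀ x, |fderiv ℝ m x v| ≤ C * (1 + ‖x‖) ^ N) :
    ∫ x, m x * u x * fderiv ℝ u x v = -(1 / 2) * ∫ x, fderiv ℝ m x v * u x ^ 2 := by
  have hu1 : ContDiff ℝ 1 u := hu.of_le one_le_two
  have hd : ∀ x, fderiv ℝ (fun y => m y * u y ^ 2) x v =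
      fderiv ℝ m x v * u x ^ 2 + 2 * (m x * u x * fderiv ℝ u x v) := by
    intro x
    have hmd : HasFDerivAt m (fderiv ℝ m x) x := (hm.differentiable one_ne_zero x).hasFDerivAt
    have hud : HasFDerivAt u (fderiv ℝ u x) x := (hu.differentiable two_ne_zero x).hasFDerivAt
    have hsq : HasFDerivAt (fun y => u y ^ 2) ((2 * u x) • fderiv ℝ u x) x := by
      simpa using hud.pow 2
    rw [(hmd.fun_mul hsq).fderiv]
    simp only [add_apply, FunLike.coe_smul, Pi.smul_apply, smul_eq_mul]
    ring
  have hU := gaussDecay_self hB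
  have hUv := gaussDecay_fderiv_apply hB v
  have ih : Integrable fun y => m y * u y ^ 2 :=
    integrable_of_gaussDecay (by norm_num) (hm.continuous.mul (hu.continuous.pow 2))
      (gaussDecay_of_le_poly_mul_mul hm0 hU hU fun x => by
        rw [abs_mul, abs_pow, sq, mul_assoc])
  have ia : Integrable fun x => fderiv ℝ m x v * u x ^ 2 :=
    integrable_of_gaussDecay (by norm_num)
      (((hm.continuous_fderiv one_ne_zero).clm_apply continuous_const).mul (hu.continuous.pow 2))
      (gaussDecay_of_le_poly_mul_mul hm1 hU hU fun x => by
        rw [abs_mul, abs_pow, sq, mul_assoc])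
  have ib : Integrable fun x => 2 * (m x * u x * fderiv ℝ u x v) :=
    integrable_of_gaussDecay (by norm_num)
      (continuous_const.mul ((hm.continuous.mul hu.continuous).mul
        (continuous_fderiv_apply_of_contDiff_two hu v)))
      (gaussDecay_of_le_poly_mul_mul (polyBound_of_le_mul (polyBound_const 2) hm0
        (H := fun x => 2 * m x) (fun x => (abs_mul _ _).le)) hU hUv fun x => by
        simp only [abs_mul]; ring_nf; rfl)
  have hI := integral_eq_neg_integral_of_fderiv_eq_add (hm.mul (hu1.pow 2)) ih v ia ib hd
  rw [integral_const_mul] at hI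
  linarith

/-! ### `∫ m u ∂_θu = −½ ∫ (∂_θ m) u²` -/

include hu hB in
/-- **The angular drift pairing**: `∫ m u ∂_θu = −½ ∫ (∂_θm) u²` for a `C¹` polynomially bounded
multiplier `m` with polynomially bounded first derivatives; in particular `∫ m u ∂_θu = 0` for RADIAL
`m` (`∂_θ m = 0`). From the coordinate version with the multipliers `x₁m`, `x₀m`. [folklore] -/
theorem integral_mul_mul_fderiv_perp_eq_of_gaussDecay {m : EuclideanSpace ℝ (Fin 2) → ℝ}
    (hm : ContDiff ℝ 1 m) (hm0 : ∃ (C : ℝ) (N : ℕ), ∀ x, |m x| ≤ C * (1 + ‖x‖) ^ N)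
    (hm1 : ∀ v, ∃ (C : ℝ) (N : ℕ), ∀ x, |fderiv ℝ m x v| ≤ C * (1 + ‖x‖) ^ N) :
    ∫ x, m x * u x * fderiv ℝ u x (perp x) =
      -(1 / 2) * ∫ x, fderiv ℝ m x (perp x) * u x ^ 2 := by
  set e₀ : EuclideanSpace ℝ (Fin 2) := EuclideanSpace.single 0 1 with he₀
  set e₁ : EuclideanSpace ℝ (Fin 2) := EuclideanSpace.single 1 1 with he₁
  have hmd : ∀ x, DifferentiableAt ℝ m x := fun x => hm.differentiable one_ne_zero x
  -- the two coordinate identities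
  have h1 := integral_mul_mul_fderiv_apply_eq_of_gaussDecay hu hB (contDiff_coord_mul hm 1)
    (polyBound_of_le_mul (polyBound_coord 1) hm0 (fun x => (abs_mul _ _).le)) e₀
    (polyBound_of_le_mul (polyBound_coord 1) (hm1 e₀) (H := fun x => fderiv ℝ (fun y => y 1 * m y) x e₀)
      (fun x => by rw [fderiv_coord_mul_apply (hmd x)]; simp [he₀]))
  have h0 := integral_mul_mul_fderiv_apply_eq_of_gaussDecay hu hB (contDiff_coord_mul hm 0)
    (polyBound_of_le_mul (polyBound_coord 0) hm0 (fun x => (abs_mul _ _).le)) e₁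
    (polyBound_of_le_mul (polyBound_coord 0) (hm1 e₁) (H := fun x => fderiv ℝ (fun y => y 0 * m y) x e₁)
      (fun x => by rw [fderiv_coord_mul_apply (hmd x)]; simp [he₁]))
  have hd1 : ∀ x, fderiv ℝ (fun y => y 1 * m y) x e₀ = x 1 * fderiv ℝ m x e₀ := fun x => by
    rw [fderiv_coord_mul_apply (hmd x)]; simp [he₀]
  have hd0 : ∀ x, fderiv ℝ (fun y => y 0 * m y) x e₁ = x 0 * fderiv ℝ m x e₁ := fun x => by
    rw [fderiv_coord_mul_apply (hmd x)]; simp [he₁]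
  simp_rw [hd1] at h1
  simp_rw [hd0] at h0
  -- integrability of the two pieces
  have hU := gaussDecay_self hB
  have iA : Integrable fun x => x 1 * m x * u x * fderiv ℝ u x e₀ :=
    integrable_of_gaussDecay (by norm_num)
      ((((contDiff_coord_mul hm 1).continuous).mul hu.continuous).mul
        (continuous_fderiv_apply_of_contDiff_two hu e₀))
      (gaussDecay_of_le_poly_mul_mul (polyBound_of_le_mul (polyBound_coord 1) hm0
        (H := fun x => x 1 * m x) (fun x => (abs_mul _ _).le)) hU (gaussDecay_fderiv_apply hB e₀)
        fun x => by rw [abs_mul, abs_mul])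
  have iB : Integrable fun x => x 0 * m x * u x * fderiv ℝ u x e₁ :=
    integrable_of_gaussDecay (by norm_num)
      ((((contDiff_coord_mul hm 0).continuous).mul hu.continuous).mul
        (continuous_fderiv_apply_of_contDiff_two hu e₁))
      (gaussDecay_of_le_poly_mul_mul (polyBound_of_le_mul (polyBound_coord 0) hm0
        (H := fun x => x 0 * m x) (fun x => (abs_mul _ _).le)) hU (gaussDecay_fderiv_apply hB e₁)
        fun x => by rw [abs_mul, abs_mul])
  have iA' : Integrable fun x => x 1 * fderiv ℝ m x e₀ * u x ^ 2 :=
    integrable_of_gaussDecay (by norm_num)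
      ((((continuous_apply 1).comp (PiLp.continuous_ofLp 2 _)).mul
        ((hm.continuous_fderiv one_ne_zero).clm_apply continuous_const)).mul (hu.continuous.pow 2))
      (gaussDecay_of_le_poly_mul_mul (polyBound_of_le_mul (polyBound_coord 1) (hm1 e₀)
        (H := fun x => x 1 * fderiv ℝ m x e₀) (fun x => (abs_mul _ _).le)) hU hU
        fun x => by rw [abs_mul, abs_pow, sq, mul_assoc])
  have iB' : Integrable fun x => x 0 * fderiv ℝ m x e₁ * u x ^ 2 :=
    integrable_of_gaussDecay (by norm_num)
      ((((continuous_apply 0).comp (PiLp.continuous_ofLp 2 _)).mul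
        ((hm.continuous_fderiv one_ne_zero).clm_apply continuous_const)).mul (hu.continuous.pow 2))
      (gaussDecay_of_le_poly_mul_mul (polyBound_of_le_mul (polyBound_coord 0) (hm1 e₁)
        (H := fun x => x 0 * fderiv ℝ m x e₁) (fun x => (abs_mul _ _).le)) hU hU
        fun x => by rw [abs_mul, abs_pow, sq, mul_assoc])
  -- expand `∂_θ` in coordinates and combine
  have eL : ∀ x, m x * u x * fderiv ℝ u x (perp x) =
      x 0 * m x * u x * fderiv ℝ u x e₁ - x 1 * m x * u x * fderiv ℝ u x e₀ := fun x => by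
    rw [fderiv_apply_perp]; ring
  have eR : ∀ x, fderiv ℝ m x (perp x) * u x ^ 2 =
      x 0 * fderiv ℝ m x e₁ * u x ^ 2 - x 1 * fderiv ℝ m x e₀ * u x ^ 2 := fun x => by
    rw [fderiv_apply_perp]; ring
  simp_rw [eL, eR]
  rw [integral_sub iB iA, integral_sub iB' iA', h1, h0]
  ring

/-! ### `∫ m u Δu = −∫ (m |∇u|² + u ∇m·∇u)` -/

include hu hB in
/-- One Green identity in a coordinate direction `e`: `∫ m u ∂ₑ∂ₑu = −∫ (∂ₑm u + m ∂ₑu) ∂ₑu`. [folklore] -/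
theorem integral_mul_mul_fderiv_fderiv_eq_of_gaussDecay {m : EuclideanSpace ℝ (Fin 2) → ℝ}
    (hm : ContDiff ℝ 1 m) (hm0 : ∃ (C : ℝ) (N : ℕ), ∀ x, |m x| ≤ C * (1 + ‖x‖) ^ N)
    (e : EuclideanSpace ℝ (Fin 2))
    (hm1 : ∃ (C : ℝ) (N : ℕ), ∀ x, |fderiv ℝ m x e| ≤ C * (1 + ‖x‖) ^ N) :
    ∫ x, m x * u x * fderiv ℝ (fderiv ℝ u) x e e =
      -∫ x, (fderiv ℝ m x e * u x + m x * fderiv ℝ u x e) * fderiv ℝ u x e := by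
  have hu1 : ContDiff ℝ 1 u := hu.of_le one_le_two
  have hd : ∀ x, fderiv ℝ (fun y => m y * u y * fderiv ℝ u y e) x e =
      (fderiv ℝ m x e * u x + m x * fderiv ℝ u x e) * fderiv ℝ u x e +
        m x * u x * fderiv ℝ (fderiv ℝ u) x e e := by
    intro x
    have hmd : HasFDerivAt m (fderiv ℝ m x) x := (hm.differentiable one_ne_zero x).hasFDerivAt
    have hud : HasFDerivAt u (fderiv ℝ u x) x := (hu.differentiable two_ne_zero x).hasFDerivAt
    have hdi : HasFDerivAt (fun y => fderiv ℝ u y e) (fderiv ℝ (fun y => fderiv ℝ u y e) x) x :=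
      ((contDiff_one_partialDeriv hu e).differentiable one_ne_zero x).hasFDerivAt
    rw [((hmd.fun_mul hud).fun_mul hdi).fderiv]
    simp only [add_apply, FunLike.coe_smul, Pi.smul_apply, smul_eq_mul, fderiv_partialDeriv_apply hu]
    ring
  have hU := gaussDecay_self hB
  have hUe := gaussDecay_fderiv_apply hB e
  have hUee := gaussDecay_fderiv_fderiv_apply hB e e
  have hce := continuous_fderiv_apply_of_contDiff_two hu e
  have ih : Integrable fun y => m y * u y * fderiv ℝ u y e :=
    integrable_of_gaussDecay (by norm_num) ((hm.continuous.mul hu.continuous).mul hce)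
      (gaussDecay_of_le_poly_mul_mul hm0 hU hUe fun x => by rw [abs_mul, abs_mul])
  have ia : Integrable fun x => (fderiv ℝ m x e * u x + m x * fderiv ℝ u x e) * fderiv ℝ u x e :=
    integrable_of_gaussDecay (by norm_num)
      (((((hm.continuous_fderiv one_ne_zero).clm_apply continuous_const).mul hu.continuous).add
        (hm.continuous.mul hce)).mul hce)
      (gaussDecay_of_le_add
        (gaussDecay_of_le_poly_mul_mul hm1 hU hUe (H := fun x => fderiv ℝ m x e * u x * fderiv ℝ u x e)
          fun x => by rw [abs_mul, abs_mul])
        (gaussDecay_of_le_poly_mul_mul hm0 hUe hUe (H := fun x => m x * fderiv ℝ u x e * fderiv ℝ u x e)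
          fun x => by rw [abs_mul, abs_mul])
        fun x => by rw [add_mul]; exact abs_add_le _ _)
  have ib : Integrable fun x => m x * u x * fderiv ℝ (fderiv ℝ u) x e e :=
    integrable_of_gaussDecay (by norm_num)
      ((hm.continuous.mul hu.continuous).mul (continuous_fderiv_fderiv_apply_of_contDiff_two hu e e))
      (gaussDecay_of_le_poly_mul_mul hm0 hU hUee fun x => by rw [abs_mul, abs_mul])
  exact integral_eq_neg_integral_of_fderiv_eq_add ((hm.mul hu1).mul (contDiff_one_partialDeriv hu e))
    ih e ia ib hd

include hu hB in
/-- **The Laplacian pairing with a multiplier** (Green once, in coordinates): for a `C¹` polynomially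
bounded multiplier `m` with polynomially bounded first derivatives,
`∫ m u Δu = −∫ (m ((∂₀u)² + (∂₁u)²) + u (∂₀m ∂₀u + ∂₁m ∂₁u))`. [folklore] -/
theorem integral_mul_mul_laplacian_eq_of_gaussDecay {m : EuclideanSpace ℝ (Fin 2) → ℝ}
    (hm : ContDiff ℝ 1 m) (hm0 : ∃ (C : ℝ) (N : ℕ), ∀ x, |m x| ≤ C * (1 + ‖x‖) ^ N)
    (hm1 : ∀ v, ∃ (C : ℝ) (N : ℕ), ∀ x, |fderiv ℝ m x v| ≤ C * (1 + ‖x‖) ^ N) :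
    ∫ x, m x * u x * Δ u x =
      -∫ x, (m x * (fderiv ℝ u x (EuclideanSpace.single 0 1) ^ 2 +
          fderiv ℝ u x (EuclideanSpace.single 1 1) ^ 2) +
        u x * (fderiv ℝ m x (EuclideanSpace.single 0 1) * fderiv ℝ u x (EuclideanSpace.single 0 1) +
          fderiv ℝ m x (EuclideanSpace.single 1 1) * fderiv ℝ u x (EuclideanSpace.single 1 1))) := by
  set e₀ : EuclideanSpace ℝ (Fin 2) := EuclideanSpace.single 0 1 with he₀
  set e₁ : EuclideanSpace ℝ (Fin 2) := EuclideanSpace.single 1 1 with he₁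
  have hlap : ∀ x, Δ u x = fderiv ℝ (fderiv ℝ u) x e₀ e₀ + fderiv ℝ (fderiv ℝ u) x e₁ e₁ := fun x => by
    rw [laplacian_eq_sum_fderiv_fderiv (EuclideanSpace.basisFun (Fin 2) ℝ) hu x, Fin.sum_univ_two,
      EuclideanSpace.basisFun_apply, EuclideanSpace.basisFun_apply, fderiv_partialDeriv_apply hu,
      fderiv_partialDeriv_apply hu]
  have h0 := integral_mul_mul_fderiv_fderiv_eq_of_gaussDecay hu hB hm hm0 e₀ (hm1 e₀)
  have h1 := integral_mul_mul_fderiv_fderiv_eq_of_gaussDecay hu hB hm hm0 e₁ (hm1 e₁)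
  have hU := gaussDecay_self hB
  -- integrability of the pieces
  have ib : ∀ e, Integrable fun x => m x * u x * fderiv ℝ (fderiv ℝ u) x e e := fun e =>
    integrable_of_gaussDecay (by norm_num)
      ((hm.continuous.mul hu.continuous).mul (continuous_fderiv_fderiv_apply_of_contDiff_two hu e e))
      (gaussDecay_of_le_poly_mul_mul hm0 hU (gaussDecay_fderiv_fderiv_apply hB e e)
        fun x => by rw [abs_mul, abs_mul])
  have ia : ∀ e, Integrable fun x =>
      (fderiv ℝ m x e * u x + m x * fderiv ℝ u x e) * fderiv ℝ u x e := by
    intro e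
    have hce := continuous_fderiv_apply_of_contDiff_two hu e
    have hUe := gaussDecay_fderiv_apply hB e
    exact integrable_of_gaussDecay (by norm_num)
      (((((hm.continuous_fderiv one_ne_zero).clm_apply continuous_const).mul hu.continuous).add
        (hm.continuous.mul hce)).mul hce)
      (gaussDecay_of_le_add
        (gaussDecay_of_le_poly_mul_mul (hm1 e) hU hUe
          (H := fun x => fderiv ℝ m x e * u x * fderiv ℝ u x e) fun x => by rw [abs_mul, abs_mul])
        (gaussDecay_of_le_poly_mul_mul hm0 hUe hUe
          (H := fun x => m x * fderiv ℝ u x e * fderiv ℝ u x e) fun x => by rw [abs_mul, abs_mul])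
        fun x => by rw [add_mul]; exact abs_add_le _ _)
  have eL : ∀ x, m x * u x * Δ u x =
      m x * u x * fderiv ℝ (fderiv ℝ u) x e₀ e₀ + m x * u x * fderiv ℝ (fderiv ℝ u) x e₁ e₁ := fun x => by
    rw [hlap]; ring
  simp_rw [eL]
  rw [integral_add (ib e₀) (ib e₁), h0, h1, ← neg_add, ← integral_add (ia e₀) (ia e₁)]
  congr 1
  refine integral_congr_ae (Eventually.of_forall fun x => ?_)
  simp only [he₀, he₁]
  ring

end Decay

/-- Registered tools stub of crux stmt-NavierStokesRegularity-17973 (`stub_oddAttenuationToolsB`):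
the drift pairings `∫ m u ∂ᵥu = −½∫ (∂ᵥm) u²`, `∫ m u ∂_θu = −½∫ (∂_θm) u²` and the Laplacian
pairing `∫ m u Δu = −∫ (m|∇u|² + u ∇m·∇u)` in the Gaussian decay class. [folklore] -/
theorem stub_oddAttenuationToolsB :
    (∀ (u : EuclideanSpace ℝ (Fin 2) → ℝ), ContDiff ℝ 2 u → (∃ (C : ℝ) (N : ℕ), ∀ x, |u x| ≤ C * (1
      + ‖x‖) ^ N * Real.exp (-(1 / 8 * ‖x‖ ^ 2)) ∧ ‖fderiv ℝ u x‖ ≤ C * (1 + ‖x‖) ^ N * Real.exp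
      (-(1 / 8 * ‖x‖ ^ 2)) ∧ ‖fderiv ℝ (fderiv ℝ u) x‖ ≤ C * (1 + ‖x‖) ^ N * Real.exp (-(1 / 8 * ‖x‖
      ^ 2))) → ∀ (m : EuclideanSpace ℝ (Fin 2) → ℝ), ContDiff ℝ 1 m → (∃ (C : ℝ) (N : ℕ), ∀ x, |m x|
      ≤ C * (1 + ‖x‖) ^ N) → (∀ v, ∃ (C : ℝ) (N : ℕ), ∀ x, |fderiv ℝ m x v| ≤ C * (1 + ‖x‖) ^ N) → ∀
      v : EuclideanSpace ℝ (Fin 2), ∫ x, m x * u x * fderiv ℝ u x v = -(1 / 2) * ∫ x, fderiv ℝ m x v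
      * u x ^ 2) ∧ (∀ (u : EuclideanSpace ℝ (Fin 2) → ℝ), ContDiff ℝ 2 u → (∃ (C : ℝ) (N : ℕ), ∀ x,
      |u x| ≤ C * (1 + ‖x‖) ^ N * Real.exp (-(1 / 8 * ‖x‖ ^ 2)) ∧ ‖fderiv ℝ u x‖ ≤ C * (1 + ‖x‖) ^ N
      * Real.exp (-(1 / 8 * ‖x‖ ^ 2)) ∧ ‖fderiv ℝ (fderiv ℝ u) x‖ ≤ C * (1 + ‖x‖) ^ N * Real.exp
      (-(1 / 8 * ‖x‖ ^ 2))) → ∀ (m : EuclideanSpace ℝ (Fin 2) → ℝ), ContDiff ℝ 1 m → (∃ (C : ℝ) (N :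
      ℕ), ∀ x, |m x| ≤ C * (1 + ‖x‖) ^ N) → (∀ v, ∃ (C : ℝ) (N : ℕ), ∀ x, |fderiv ℝ m x v| ≤ C * (1
      + ‖x‖) ^ N) → ∫ x, m x * u x * fderiv ℝ u x (perp x) = -(1 / 2) * ∫ x, fderiv ℝ m x (perp x) *
      u x ^ 2) ∧ (∀ (u : EuclideanSpace ℝ (Fin 2) → ℝ), ContDiff ℝ 2 u → (∃ (C : ℝ) (N : ℕ), ∀ x, |u
      x| ≤ C * (1 + ‖x‖) ^ N * Real.exp (-(1 / 8 * ‖x‖ ^ 2)) ∧ ‖fderiv ℝ u x‖ ≤ C * (1 + ‖x‖) ^ N *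
      Real.exp (-(1 / 8 * ‖x‖ ^ 2)) ∧ ‖fderiv ℝ (fderiv ℝ u) x‖ ≤ C * (1 + ‖x‖) ^ N * Real.exp (-(1
      / 8 * ‖x‖ ^ 2))) → ∀ (m : EuclideanSpace ℝ (Fin 2) → ℝ), ContDiff ℝ 1 m → (∃ (C : ℝ) (N : ℕ),
      ∀ x, |m x| ≤ C * (1 + ‖x‖) ^ N) → (∀ v, ∃ (C : ℝ) (N : ℕ), ∀ x, |fderiv ℝ m x v| ≤ C * (1 +
      ‖x‖) ^ N) → ∫ x, m x * u x * Δ u x = -∫ x, (m x * (fderiv ℝ u x (EuclideanSpace.single 0 1) ^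
      2 + fderiv ℝ u x (EuclideanSpace.single 1 1) ^ 2) + u x * (fderiv ℝ m x (EuclideanSpace.single
      0 1) * fderiv ℝ u x (EuclideanSpace.single 0 1) + fderiv ℝ m x (EuclideanSpace.single 1 1) *
      fderiv ℝ u x (EuclideanSpace.single 1 1)))) :=
  ⟨fun _ hu hB _ hm hm0 hm1 v => integral_mul_mul_fderiv_apply_eq_of_gaussDecay hu hB hm hm0 v (hm1 v),
    fun _ hu hB _ hm hm0 hm1 => integral_mul_mul_fderiv_perp_eq_of_gaussDecay hu hB hm hm0 hm1,
    fun _ hu hB _ hm hm0 hm1 => integral_mul_mul_laplacian_eq_of_gaussDecay hu hB hm hm0 hm1⟩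

end Summit.NavierStokesRegularity.NavierStokesRegularity.Theorems
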